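import Literature.Topology.FourManifolds.GluckTwistUniqueness
import Literature.Topology.FourManifolds.GluckTwistExistence
import Literature.Topology.FourManifolds.ChartTransport
import Literature.Topology.FourManifolds.StraightLineIsotopyExtension
import Mathlib.Geometry.Manifold.ContMDiffMFDeriv
import Mathlib.Geometry.Manifold.MFDeriv.Atlas
import Mathlib.Analysis.InnerProductSpace.Calculus
import Mathlib.Analysis.Normed.Module.Normalize
import HarnessLib

/-!
# Uniqueness of tubular neighbourhoods of 2-knots; the Gluck twist is well defined

Topic `Literature/Topology/FourManifolds`. This file **discharges** two named facts of the tree: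

* `Literature.Topology.FourManifolds.TwoKnot.TubularNbhd.uniqueness` (`GluckTwistUniqueness.lean`; Kosinski, *Differential
  Manifolds* (1993), Ch. III, Thm. (3.5), the Tubular Neighbourhood Theorem, in the form needed
  for 2-knots in `S⁴`): `TwoKnot.TubularNbhd.uniqueness_holds`;
* `Literature.Topology.FourManifolds.nonempty_diffeomorph_of_isGluckTwist` (`GluckTwist.lean`; H. Gluck, *The embedding of
  two-spheres in the four-sphere*, Trans. AMS 104 (1962), §8: the Gluck twist `Σ_K` depends
  neither on the tubular neighbourhood nor on the 2-knot within its ambient isotopy class):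
  `nonempty_diffeomorph_of_isGluckTwist_holds`, by the reduction
  `nonempty_diffeomorph_of_isGluckTwist_of_uniqueness` proved in `GluckTwistUniqueness.lean`
  (transport, locality and fibre files of the decomposition).

## The proof of the uniqueness of tubular neighbourhoods

Let `ν₁, ν₂ : S² × ℝ² ↪ S⁴` be tubular neighbourhoods of the 2-knot `K` (`νᵢ (x, 0) = K x`).

1. *Transition map.* `τ = ν₂⁻¹ ∘ ν₁` (`Literature.Topology.FourManifolds.tubeTransition`) is smooth near the zero section, fixes
   it pointwise, and its differential there is block triangular, `Dτ(x,0)(ξ, v) = (ξ + β v, A(x) v)`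
   with the **fibre derivative** `A(x) = ∂_w(pr₂ τ)(x, 0) ∈ GL(2, ℝ)` (`Literature.Topology.FourManifolds.fibreDeriv`,
   `mfderiv_tubeTransition_snd`, `mfderiv_tubeTransition_horizontal`, `injective_fibreDeriv`),
   smooth in `x` (`contMDiff_fibreDeriv`, Mathlib's `ContMDiffAt.mfderiv`). Kosinski III.(3.1).
2. *Orthogonal frame (Gram–Schmidt).* `Q(x) = [u(x), s J u(x)]` with `u = A e₀ / ‖A e₀‖`, `J` the
   quarter turn and `s = ±1` the (constant, `S²` being connected) sign of `⟪A e₁, J u⟫`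
   (`Literature.Topology.FourManifolds.tubeFrame`; the `O(2)`-reduction, Kosinski II.(4.6), done by hand in rank `2`). The segment
   `(1 - t) A(x) + t Q(x)`, `0 ≤ t ≤ 1`, consists of invertible maps (`injective_lineToFrame`:
   `A = Q R` with `R` upper triangular of positive diagonal).
3. *Straight-line isotopy.* In a stereographic chart `ℝ⁴ = S⁴ ∖ {pt}` with `pt ∉ range ν₂`
   (`exists_not_mem_range`), the map `P = ν₂ ∘ (id × Q) ∘ ν₁⁻¹` is smooth near the (compact) knot,
   fixes it pointwise, and `D((1 - t) id + t P)` is injective along the knot: composed with the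
   surjection `D(σ ∘ ν₁)(x, 0)` it equals `D(σ ∘ ν₂)(x, 0) ∘ ((1 - t) Dτ + t D(id × Q))(x, 0)`,
   injective by 1–2.
4. *Isotopy extension* (`Literature.Topology.FourManifolds.exists_diffeomorph_eqOn_nhdsSet_of_straightLine`,
   `StraightLineIsotopyExtension.lean`: flow of a compactly supported time-dependent vector field,
   Hirsch (1976), Ch. 8, Thm. 1.3) gives a diffeomorphism of `ℝ⁴` equal to `P` near the knot and
   to the identity off a ball; transported to `S⁴` (`Literature.Topology.FourManifolds.exists_diffeomorph_chartTransport`) it is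
   the required `φ` with `φ ∘ ν₁ = ν₂ ∘ (id × Q)` on a tube `S² × B_r` and `φ ∘ K = K`.

## References

* A. Kosinski, *Differential Manifolds*, Academic Press (1993), Ch. III, Thms. (3.1), (3.5);
  Ch. II, (4.6), (5.2). [Kosinski1993]
* M. W. Hirsch, *Differential Topology*, GTM 33 (1976), Ch. 4 §5 (Thm. 5.3), Ch. 8 §1
  (Thms. 1.3–1.4). [Hirsch1976]
* H. Gluck, *The embedding of two-spheres in the four-sphere*, Trans. Amer. Math. Soc. 104 (1962)
  308–333, §8. [GluckTAMS1962]

## Design notes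

* Differentials on the product manifold `S² × ℝ²` are handled through Mathlib's
  `mfderiv_prod_eq_add_apply`, `mfderiv_prod_left` and `mfderiv_eq_fderiv`; since these see
  through the definition of `TangentSpace`, component identities are extracted with
  `congrArg Prod.snd` / definitional unfolding rather than rewriting.
* `planeE0` / `planeE1` are the standard basis pair of `ℝ²`; `planeE0` is `rfl`-equal to the
  ad-hoc `TwoKnot.TubularNbhd.unitVec₀` of `GluckTwistExistence.lean`, which the pair supersedes
  (the librarian may merge them). Normalisation of vectors is Mathlib's `NormedSpace.normalize`.
* Injectivity of the differentials of `ν` and `ν⁻¹` is derived cheaply from the smooth one-sided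
  inverses (`TwoKnot.TubularNbhd.injective_mfderiv_toFun`, `injective_mfderiv_toHomeo_symm`)
  rather than from the tree's general `mfderiv_injective_of_isImmersion`
  (`DehnSurgeryTubularNbhdProofs.lean`), to keep the import closure small.
* Everything in this file is proved; no named facts are introduced; no `sorry`.
-/

noncomputable section

open Set Function Metric Filter
open scoped Manifold ContDiff Topology RealInnerProductSpace

namespace Literature.Topology.FourManifolds

/-- Local notation: `𝔼 n` is the model Euclidean space `EuclideanSpace ℝ (Fin n)`. -/
local notation "𝔼 " n:arg => EuclideanSpace ℝ (Fin n)

/-- Local notation: `𝕊 n` is the unit sphere in `EuclideanSpace ℝ (Fin (n + 1))`. -/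
local notation "𝕊 " n:arg => (Metric.sphere (0 : EuclideanSpace ℝ (Fin (n + 1))) 1)

/-- Local notation: the model with corners of the tube `𝕊 2 × ℝ²`. -/
local notation "I𝕋" => (ModelWithCorners.prod (𝓡 2) 𝓘(ℝ, EuclideanSpace ℝ (Fin 2)))

/-! ### The orthonormal frame of an invertible `2 × 2` matrix (Gram–Schmidt in the plane) -/

section PlaneQR

/-- The first standard basis vector `e₀ = (1, 0)` of the plane. [folklore] -/
def planeE0 : 𝔼 2 := EuclideanSpace.single 0 1

/-- The second standard basis vector `e₁ = (0, 1)` of the plane. [folklore] -/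
def planeE1 : 𝔼 2 := EuclideanSpace.single 1 1

/-- Coordinates of `e₀`. [folklore] -/
@[simp] theorem planeE0_apply_zero : planeE0 0 = 1 := by simp [planeE0]

/-- Coordinates of `e₀`. [folklore] -/
@[simp] theorem planeE0_apply_one : planeE0 1 = 0 := by simp [planeE0]

/-- Coordinates of `e₁`. [folklore] -/
@[simp] theorem planeE1_apply_zero : planeE1 0 = 0 := by simp [planeE1]

/-- Coordinates of `e₁`. [folklore] -/
@[simp] theorem planeE1_apply_one : planeE1 1 = 1 := by simp [planeE1]

/-- Expansion of a vector of the plane in the standard basis. [folklore] -/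
theorem plane_eq_smul_add_smul (w : 𝔼 2) : w = w 0 • planeE0 + w 1 • planeE1 := by
  ext i
  fin_cases i <;> simp

/-- Coordinates of the quarter turn. [folklore] -/
@[simp] theorem quarterTurn_apply_zero (u : 𝔼 2) : quarterTurn u 0 = -(u 1) := rfl

/-- Coordinates of the quarter turn. [folklore] -/
@[simp] theorem quarterTurn_apply_one (u : 𝔼 2) : quarterTurn u 1 = u 0 := rfl

/-- `J u ⊥ u`. [folklore] -/
theorem inner_quarterTurn_right (u : 𝔼 2) : ⟪u, quarterTurn u⟫ = 0 := by
  simp [PiLp.inner_apply, Fin.sum_univ_two]; ring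

/-- `J u ⊥ u`. [folklore] -/
theorem inner_quarterTurn_left (u : 𝔼 2) : ⟪quarterTurn u, u⟫ = 0 := by
  simp [PiLp.inner_apply, Fin.sum_univ_two]; ring

/-- `⟪J u, J v⟫ = ⟪u, v⟫`. [folklore] -/
theorem inner_quarterTurn_quarterTurn (u v : 𝔼 2) : ⟪quarterTurn u, quarterTurn v⟫ = ⟪u, v⟫ := by
  simp [PiLp.inner_apply, Fin.sum_univ_two]; ring

/-- The quarter turn of `0` is `0`. [folklore] -/
@[simp] theorem quarterTurn_zero : quarterTurn 0 = 0 := by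
  ext i; fin_cases i <;> simp

/-- The **frame map** `w ↦ w₀ u + s w₁ J u` attached to a vector `u` and a sign `s`: for a unit
vector `u` and `s = ±1` this is the linear isometry with matrix `[u, s J u]` (the orthogonal
factor of the `QR` decomposition of a matrix with first column proportional to `u`).
[folklore] -/
def frameMap (u : 𝔼 2) (s : ℝ) : 𝔼 2 →L[ℝ] 𝔼 2 :=
  (EuclideanSpace.proj (0 : Fin 2)).smulRight u +
    (s • EuclideanSpace.proj (1 : Fin 2)).smulRight (quarterTurn u)

/-- The frame map, unfolded. [folklore] -/
@[simp]
theorem frameMap_apply (u : 𝔼 2) (s : ℝ) (w : 𝔼 2) :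
    frameMap u s w = w 0 • u + (s * w 1) • quarterTurn u := by
  simp [frameMap]

/-- The frame map of a unit vector and a sign preserves inner products. [folklore] -/
theorem inner_frameMap {u : 𝔼 2} (hu : ‖u‖ = 1) {s : ℝ} (hs : s ^ 2 = 1) (v w : 𝔼 2) :
    ⟪frameMap u s v, frameMap u s w⟫ = ⟪v, w⟫ := by
  have huu : ⟪u, u⟫ = 1 := by rw [real_inner_self_eq_norm_sq, hu, one_pow]
  have hJJ : ⟪quarterTurn u, quarterTurn u⟫ = 1 := by rw [inner_quarterTurn_quarterTurn, huu]
  simp only [frameMap_apply, inner_add_left, inner_add_right, inner_smul_left, inner_smul_right,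
    huu, hJJ, inner_quarterTurn_right, inner_quarterTurn_left, RCLike.conj_to_real]
  have hvw : ⟪v, w⟫ = v 0 * w 0 + v 1 * w 1 := by
    simp [PiLp.inner_apply, Fin.sum_univ_two, mul_comm]
  rw [hvw]
  have hs' : s * s = 1 := by rw [← sq, hs]
  linear_combination (v 1 * w 1) * hs'

/-- The frame map of a unit vector and a sign, as a linear isometry equivalence of the plane.
[folklore] -/
def frameIsometry (u : 𝔼 2) (s : ℝ) (hu : ‖u‖ = 1) (hs : s ^ 2 = 1) : 𝔼 2 ≃ₗᵢ[ℝ] 𝔼 2 :=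
  ((frameMap u s).toLinearMap.isometryOfInner (inner_frameMap hu hs)).toLinearIsometryEquiv rfl

/-- The frame isometry, unfolded. [folklore] -/
@[simp]
theorem frameIsometry_apply (u : 𝔼 2) (s : ℝ) (hu : ‖u‖ = 1) (hs : s ^ 2 = 1) (w : 𝔼 2) :
    frameIsometry u s hu hs w = w 0 • u + (s * w 1) • quarterTurn u := by
  simp [frameIsometry]

/-- **The straight line from an invertible matrix to its orthogonal frame stays invertible.**
Let `A` be an injective linear map of the plane, `u = A e₀ / ‖A e₀‖`, and `s = ±1` the sign
of `⟪A e₁, J u⟫` (the sign of `det A`). Then `(1 - t) A + t Q` is injective for `0 ≤ t ≤ 1`,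
where `Q = [u, s J u]` is the orthogonal factor of the `QR` decomposition `A = Q R` (`R` upper
triangular with positive diagonal, so that `(1 - t) R + t` is again such). [folklore] -/
theorem injective_lineToFrame {A : 𝔼 2 →L[ℝ] 𝔼 2} (hA : Injective A) {s : ℝ} (hs : s ^ 2 = 1)
    (hsc : 0 < s * ⟪A planeE1, quarterTurn (NormedSpace.normalize (A planeE0))⟫) {t : ℝ}
    (ht : t ∈ Icc (0 : ℝ) 1) :
    Injective ((1 - t) • A + t • frameMap (NormedSpace.normalize (A planeE0)) s) := by
  set a₁ := A planeE0 with ha₁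
  set a₂ := A planeE1 with ha₂
  have ha₁0 : a₁ ≠ 0 := by
    intro h
    have : planeE0 = 0 := hA (by rw [← ha₁, h, map_zero])
    have h1 := congrArg (fun w : 𝔼 2 => w 0) this
    simp at h1
  set n : ℝ := ‖a₁‖ with hn
  have hn0 : 0 < n := norm_pos_iff.2 ha₁0
  set u := NormedSpace.normalize a₁ with hu
  have hu1 : ‖u‖ = 1 := NormedSpace.norm_normalize ha₁0
  have huu : ⟪u, u⟫ = 1 := by rw [real_inner_self_eq_norm_sq, hu1, one_pow]
  have hJJ : ⟪quarterTurn u, quarterTurn u⟫ = 1 := by rw [inner_quarterTurn_quarterTurn, huu]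
  have ha₁u : a₁ = n • u := (NormedSpace.norm_smul_normalize a₁).symm
  set c : ℝ := ⟪a₂, quarterTurn u⟫ with hc
  rw [injective_iff_map_eq_zero]
  intro w hw
  have h : w 0 • ((1 - t) • a₁ + t • u) + w 1 • ((1 - t) • a₂ + t • (s • quarterTurn u)) = 0 := by
    have h := hw
    rw [plane_eq_smul_add_smul w] at h
    simp only [map_add, map_smul, add_apply, FunLike.coe_smul, Pi.smul_apply,
      frameMap_apply, planeE0_apply_zero, planeE0_apply_one, planeE1_apply_zero,
      planeE1_apply_one, mul_one, mul_zero, one_smul, zero_smul, add_zero, zero_add] at h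
    rw [← ha₁, ← ha₂] at h
    convert h using 2
  have ha₁J : ⟪a₁, quarterTurn u⟫ = 0 := by
    rw [ha₁u, inner_smul_left, inner_quarterTurn_right, mul_zero]
  have ha₁u' : ⟪a₁, u⟫ = n := by
    rw [ha₁u, inner_smul_left, huu, RCLike.conj_to_real, mul_one]
  -- inner product with `J u`
  have h1 : w 1 * ((1 - t) * c + t * s) = 0 := by
    have h' := congrArg (fun v => ⟪v, quarterTurn u⟫) h
    simp only [inner_add_left, inner_smul_left, inner_zero_left, RCLike.conj_to_real, ha₁J,
      inner_quarterTurn_right, hJJ, ← hc] at h'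
    linear_combination h'
  have hpos1 : 0 < (1 - t) * (s * c) + t := by
    rcases eq_or_lt_of_le ht.1 with h0 | h0
    · rw [← h0]; simpa using hsc
    · have : 0 ≤ (1 - t) * (s * c) := mul_nonneg (by linarith [ht.2]) hsc.le
      linarith
  have hs1 : s * s = 1 := by rw [← sq, hs]
  have hw1 : w 1 = 0 := by
    have hne : (1 - t) * c + t * s ≠ 0 := by
      intro h0
      have : s * ((1 - t) * c + t * s) = (1 - t) * (s * c) + t := by linear_combination t * hs1
      rw [h0, mul_zero] at this
      linarith
    exact (mul_eq_zero.1 h1).resolve_right hne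
  -- inner product with `u`
  have h2 : w 0 * ((1 - t) * n + t) = 0 := by
    have h' := congrArg (fun v => ⟪v, u⟫) h
    simp only [inner_add_left, inner_smul_left, inner_zero_left, RCLike.conj_to_real, ha₁u', huu,
      inner_quarterTurn_left, hw1] at h'
    linear_combination h'
  have hpos2 : 0 < (1 - t) * n + t := by
    rcases eq_or_lt_of_le ht.1 with h0 | h0
    · rw [← h0]; simpa using hn0
    · have : 0 ≤ (1 - t) * n := mul_nonneg (by linarith [ht.2]) hn0.le
      linarith
  have hw0 : w 0 = 0 := (mul_eq_zero.1 h2).resolve_right hpos2.ne'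
  rw [plane_eq_smul_add_smul w, hw0, hw1, zero_smul, zero_smul, add_zero]

/-- If `⟪A e₁, J u⟫ = 0` for `u = A e₀ / ‖A e₀‖` then `A` is not injective (its columns are
parallel). [folklore] -/
theorem inner_frame_ne_zero {A : 𝔼 2 →L[ℝ] 𝔼 2} (hA : Injective A) :
    ⟪A planeE1, quarterTurn (NormedSpace.normalize (A planeE0))⟫ ≠ 0 := by
  intro hc
  set a₁ := A planeE0 with ha₁
  set a₂ := A planeE1 with ha₂
  have ha₁0 : a₁ ≠ 0 := by
    intro h
    have : planeE0 = 0 := hA (by rw [← ha₁, h, map_zero])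
    have h1 := congrArg (fun w : 𝔼 2 => w 0) this
    simp at h1
  set u := NormedSpace.normalize a₁ with hu
  have hu1 : ‖u‖ = 1 := NormedSpace.norm_normalize ha₁0
  -- expand `a₂` in the orthonormal basis `(u, J u)`: the `J u`-component vanishes
  have hexp : a₂ = ⟪a₂, u⟫ • u := by
    have hu' : u 0 ^ 2 + u 1 ^ 2 = 1 := by
      have := hu1
      rw [EuclideanSpace.norm_eq, Real.sqrt_eq_one, Fin.sum_univ_two] at this
      simpa [Real.norm_eq_abs, sq_abs] using this
    have hc' : -(a₂ 0 * u 1) + a₂ 1 * u 0 = 0 := by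
      simpa [PiLp.inner_apply, Fin.sum_univ_two, mul_comm] using hc
    have hip : ⟪a₂, u⟫ = a₂ 0 * u 0 + a₂ 1 * u 1 := by
      simp [PiLp.inner_apply, Fin.sum_univ_two, mul_comm]
    ext i
    fin_cases i
    · simp only [Fin.zero_eta, PiLp.smul_apply, smul_eq_mul, hip]
      linear_combination (-(a₂ 0)) * hu' + (- u 1) * hc'
    · simp only [Fin.mk_one, PiLp.smul_apply, smul_eq_mul, hip]
      linear_combination (-(a₂ 1)) * hu' + u 0 * hc'
  -- hence `A (e₁ - k e₀) = 0` with `k = ⟪a₂, u⟫ / ‖a₁‖`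
  set k : ℝ := ⟪a₂, u⟫ * ‖a₁‖⁻¹ with hk
  have hker : A (planeE1 - k • planeE0) = 0 := by
    rw [map_sub, map_smul, ← ha₁, ← ha₂, hexp, hk, hu, NormedSpace.normalize, smul_smul, sub_self]
  have := hA (hker.trans (map_zero A).symm)
  have h1 := congrArg (fun w : 𝔼 2 => w 1) this
  simp at h1

end PlaneQR

/-! ### Differentials of tubular neighbourhood maps -/

namespace TwoKnot.TubularNbhd

variable {K : TwoKnot} (ν : TwoKnot.TubularNbhd K)

/-- `ν` is `C^∞` at every point. [folklore] -/
theorem contMDiffAt_toFun (q : (𝕊 2) × 𝔼 2) : ContMDiffAt I𝕋 (𝓡 4) ∞ ν.toFun q :=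
  ν.isSmoothEmbedding.contMDiff.contMDiffAt

/-- The inverse of `ν` is `C^∞` at the points of the range. [folklore] -/
theorem contMDiffAt_toHomeo_symm {p : 𝕊 4} (hp : p ∈ range ν.toFun) :
    ContMDiffAt (𝓡 4) I𝕋 ∞ ν.toHomeo.symm p :=
  ν.contMDiffOn_toHomeo_symm.contMDiffAt (ν.isOpen_range.mem_nhds hp)

/-- `ν ∘ ν⁻¹ = id` near every point of the (open) range. [folklore] -/
theorem toFun_toHomeo_symm_eventuallyEq {p : 𝕊 4} (hp : p ∈ range ν.toFun) :
    (ν.toFun ∘ ν.toHomeo.symm) =ᶠ[𝓝 p] id := by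
  filter_upwards [ν.isOpen_range.mem_nhds hp] with p' hp'
  have h := ν.toHomeo.right_inv (show p' ∈ ν.toHomeo.target by rwa [ν.toHomeo_target])
  simpa using h

/-- **The differential of a tubular neighbourhood map is injective** (it has the smooth left
inverse `ν⁻¹` on the open range). [folklore] -/
theorem injective_mfderiv_toFun (q : (𝕊 2) × 𝔼 2) : Injective (mfderiv I𝕋 (𝓡 4) ν.toFun q) := by
  have h1 : HasMFDerivAt I𝕋 (𝓡 4) ν.toFun q (mfderiv I𝕋 (𝓡 4) ν.toFun q) :=
    ((ν.contMDiffAt_toFun q).mdifferentiableAt (by simp)).hasMFDerivAt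
  have h2 : HasMFDerivAt (𝓡 4) I𝕋 ν.toHomeo.symm (ν.toFun q)
      (mfderiv (𝓡 4) I𝕋 ν.toHomeo.symm (ν.toFun q)) :=
    ((ν.contMDiffAt_toHomeo_symm ⟨q, rfl⟩).mdifferentiableAt (by simp)).hasMFDerivAt
  have hc := h2.comp q h1
  have hid : (ν.toHomeo.symm ∘ ν.toFun) = id := funext fun q' => ν.toHomeo_symm_apply q'
  rw [hid] at hc
  have heq := (hasMFDerivAt_id (I := I𝕋) q).mfderiv ▸ hc.mfderiv
  -- `heq : id = symm' ∘ ν'`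
  have key : ∀ w, mfderiv (𝓡 4) I𝕋 ν.toHomeo.symm (ν.toFun q) (mfderiv I𝕋 (𝓡 4) ν.toFun q w) = w :=
    fun w => ((ContinuousLinearMap.ext_iff.1 heq) w).symm
  exact Function.LeftInverse.injective key

/-- **The differential of `ν⁻¹` is injective at the points of the range** (`ν ∘ ν⁻¹ = id`
near such points). [folklore] -/
theorem injective_mfderiv_toHomeo_symm {p : 𝕊 4} (hp : p ∈ range ν.toFun) :
    Injective (mfderiv (𝓡 4) I𝕋 ν.toHomeo.symm p) := by
  have h2 : HasMFDerivAt (𝓡 4) I𝕋 ν.toHomeo.symm p (mfderiv (𝓡 4) I𝕋 ν.toHomeo.symm p) :=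
    ((ν.contMDiffAt_toHomeo_symm hp).mdifferentiableAt (by simp)).hasMFDerivAt
  have h1 : HasMFDerivAt I𝕋 (𝓡 4) ν.toFun (ν.toHomeo.symm p)
      (mfderiv I𝕋 (𝓡 4) ν.toFun (ν.toHomeo.symm p)) :=
    ((ν.contMDiffAt_toFun _).mdifferentiableAt (by simp)).hasMFDerivAt
  have hc := (h1.comp p h2).congr_of_eventuallyEq (ν.toFun_toHomeo_symm_eventuallyEq hp).symm
  have heq := (hasMFDerivAt_id (I := 𝓡 4) p).mfderiv ▸ hc.mfderiv
  have key : ∀ w, mfderiv I𝕋 (𝓡 4) ν.toFun (ν.toHomeo.symm p)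
      (mfderiv (𝓡 4) I𝕋 ν.toHomeo.symm p w) = w :=
    fun w => ((ContinuousLinearMap.ext_iff.1 heq) w).symm
  exact Function.LeftInverse.injective key

end TwoKnot.TubularNbhd

/-! ### The transition map of two tubular neighbourhoods -/

section Transition

variable {K : TwoKnot} (ν₁ ν₂ : TwoKnot.TubularNbhd K)

/-- The **transition map** `τ = ν₂⁻¹ ∘ ν₁` of two tubular neighbourhoods of the same 2-knot
(defined everywhere, meaningful on `ν₁⁻¹(range ν₂)`); Kosinski (1993), III §3. [folklore] -/
def tubeTransition : (𝕊 2) × 𝔼 2 → (𝕊 2) × 𝔼 2 := ν₂.toHomeo.symm ∘ ν₁.toFun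

/-- The domain `ν₁⁻¹(range ν₂)` of the transition map. [folklore] -/
def tubeTransitionDom : Set ((𝕊 2) × 𝔼 2) := ν₁.toFun ⁻¹' range ν₂.toFun

/-- The domain of the transition map is open. [folklore] -/
theorem isOpen_tubeTransitionDom : IsOpen (tubeTransitionDom ν₁ ν₂) :=
  ν₂.isOpen_range.preimage ν₁.isSmoothEmbedding.contMDiff.continuous

/-- The zero section lies in the domain of the transition map. [folklore] -/
theorem mem_tubeTransitionDom_zero (x : 𝕊 2) :
    ((x, (0 : 𝔼 2)) : (𝕊 2) × 𝔼 2) ∈ tubeTransitionDom ν₁ ν₂ := by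
  show ν₁.toFun (x, 0) ∈ range ν₂.toFun
  rw [ν₁.apply_zero, ← ν₂.apply_zero]
  exact ⟨_, rfl⟩

/-- The transition map fixes the zero section pointwise. [folklore] -/
@[simp]
theorem tubeTransition_zero (x : 𝕊 2) : tubeTransition ν₁ ν₂ (x, 0) = (x, 0) := by
  simp only [tubeTransition, comp_apply, ν₁.apply_zero]
  rw [← ν₂.apply_zero x, ν₂.toHomeo_symm_apply]

/-- `ν₂ ∘ τ = ν₁` on the domain. [folklore] -/
theorem apply_tubeTransition {q : (𝕊 2) × 𝔼 2} (hq : q ∈ tubeTransitionDom ν₁ ν₂) :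
    ν₂.toFun (tubeTransition ν₁ ν₂ q) = ν₁.toFun q := by
  have h := ν₂.toHomeo.right_inv (show ν₁.toFun q ∈ ν₂.toHomeo.target by rwa [ν₂.toHomeo_target])
  simpa [tubeTransition] using h

/-- The transition map is `C^∞` on its domain. [folklore] -/
theorem contMDiffAt_tubeTransition {q : (𝕊 2) × 𝔼 2} (hq : q ∈ tubeTransitionDom ν₁ ν₂) :
    ContMDiffAt I𝕋 I𝕋 ∞ (tubeTransition ν₁ ν₂) q :=
  (ν₂.contMDiffAt_toHomeo_symm hq).comp q (ν₁.contMDiffAt_toFun q)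

/-- The transition map is differentiable at the points of the zero section. [folklore] -/
theorem mdifferentiableAt_tubeTransition (x : 𝕊 2) :
    MDifferentiableAt I𝕋 I𝕋 (tubeTransition ν₁ ν₂) (x, 0) :=
  (contMDiffAt_tubeTransition ν₁ ν₂ (mem_tubeTransitionDom_zero ν₁ ν₂ x)).mdifferentiableAt
    (by simp)

/-- **The differential of the transition map is injective** at the zero section. [folklore] -/
theorem injective_mfderiv_tubeTransition (x : 𝕊 2) :
    Injective (mfderiv I𝕋 I𝕋 (tubeTransition ν₁ ν₂) (x, 0)) := by
  have h1 := ((ν₁.contMDiffAt_toFun (x, 0)).mdifferentiableAt (by simp)).hasMFDerivAt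
  have h2 := ((ν₂.contMDiffAt_toHomeo_symm (mem_tubeTransitionDom_zero ν₁ ν₂ x)).mdifferentiableAt
    (by simp)).hasMFDerivAt
  have hc := h2.comp ((x, (0 : 𝔼 2)) : (𝕊 2) × 𝔼 2) h1
  rw [show ν₂.toHomeo.symm ∘ ν₁.toFun = tubeTransition ν₁ ν₂ from rfl] at hc
  rw [hc.mfderiv]
  intro u v huv
  exact ν₁.injective_mfderiv_toFun _
    (ν₂.injective_mfderiv_toHomeo_symm (mem_tubeTransitionDom_zero ν₁ ν₂ x) huv)

/-- The **fibre derivative** `A(x) = ∂_w (pr₂ ∘ τ)(x, 0)` of the transition map along the zero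
section: the linear part, in the fibre direction, of the change of tubular neighbourhood
(Kosinski (1993), III.(3.1): the vector bundle map underlying `ν₂⁻¹ ∘ ν₁`). [folklore] -/
def fibreDeriv (x : 𝕊 2) : 𝔼 2 →L[ℝ] 𝔼 2 :=
  fderiv ℝ (fun w : 𝔼 2 => (tubeTransition ν₁ ν₂ (x, w)).2) 0

/-- The fibre partial map `w ↦ τ (x, w)` is differentiable at `0`. [folklore] -/
theorem mdifferentiableAt_tubeTransition_fibre (x : 𝕊 2) :
    MDifferentiableAt 𝓘(ℝ, 𝔼 2) I𝕋 (fun w : 𝔼 2 => tubeTransition ν₁ ν₂ (x, w)) 0 := by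
  have h : ContMDiffAt 𝓘(ℝ, 𝔼 2) I𝕋 ∞ (fun w : 𝔼 2 => tubeTransition ν₁ ν₂ (x, w)) 0 :=
    (contMDiffAt_tubeTransition ν₁ ν₂ (mem_tubeTransitionDom_zero ν₁ ν₂ x)).comp 0
      (contMDiffAt_const.prodMk contMDiffAt_id)
  exact h.mdifferentiableAt (by simp)

/-- The second component of the fibre partial derivative of `τ` is the fibre derivative.
[folklore] -/
theorem mfderiv_tubeTransition_fibre_snd (x : 𝕊 2) (v : 𝔼 2) :
    (mfderiv 𝓘(ℝ, 𝔼 2) I𝕋 (fun w : 𝔼 2 => tubeTransition ν₁ ν₂ (x, w)) 0 v).2 =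
      fibreDeriv ν₁ ν₂ x v := by
  have hGd := mdifferentiableAt_tubeTransition_fibre ν₁ ν₂ x
  have hc := mfderiv_comp (0 : 𝔼 2) (mdifferentiableAt_snd (I := 𝓡 2) (I' := 𝓘(ℝ, 𝔼 2))) hGd
  rw [mfderiv_snd] at hc
  have hf : mfderiv 𝓘(ℝ, 𝔼 2) 𝓘(ℝ, 𝔼 2) (Prod.snd ∘ fun w : 𝔼 2 => tubeTransition ν₁ ν₂ (x, w)) 0 =
      fibreDeriv ν₁ ν₂ x := by
    rw [mfderiv_eq_fderiv]; rfl
  rw [← hf, hc]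
  rfl

/-- **Block structure of the differential of the transition map at the zero section**:
`Dτ(x, 0) (ξ, v) = (ξ + β v, A(x) v)` — the second component is the fibre derivative.
[folklore] -/
theorem mfderiv_tubeTransition_snd (x : 𝕊 2) (u : TangentSpace I𝕋 ((x, (0 : 𝔼 2)) : (𝕊 2) × 𝔼 2)) :
    (mfderiv I𝕋 I𝕋 (tubeTransition ν₁ ν₂) (x, 0) u).2 = fibreDeriv ν₁ ν₂ x u.2 := by
  have hτ := mdifferentiableAt_tubeTransition ν₁ ν₂ x
  -- second component as the derivative of `pr₂ ∘ τ`
  have hc := mfderiv_comp ((x, (0 : 𝔼 2)) : (𝕊 2) × 𝔼 2)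
    (mdifferentiableAt_snd (I := 𝓡 2) (I' := 𝓘(ℝ, 𝔼 2))) hτ
  rw [mfderiv_snd] at hc
  have h1 : (mfderiv I𝕋 I𝕋 (tubeTransition ν₁ ν₂) (x, 0) u).2 =
      mfderiv I𝕋 𝓘(ℝ, 𝔼 2) (Prod.snd ∘ tubeTransition ν₁ ν₂) (x, 0) u := by
    rw [hc]; rfl
  have hg : MDifferentiableAt I𝕋 𝓘(ℝ, 𝔼 2) (Prod.snd ∘ tubeTransition ν₁ ν₂) (x, 0) :=
    (mdifferentiableAt_snd (I := 𝓡 2) (I' := 𝓘(ℝ, 𝔼 2))).comp _ hτ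
  have hdec := mfderiv_prod_eq_add_apply (v := u) hg
  have h2 : (fun z : 𝕊 2 =>
      (Prod.snd ∘ tubeTransition ν₁ ν₂) (z, ((x, (0 : 𝔼 2)) : (𝕊 2) × 𝔼 2).2)) =
      fun _ => (0 : 𝔼 2) := by
    funext z
    simp [tubeTransition_zero]
  rw [h2, mfderiv_const] at hdec
  rw [h1, hdec]
  have h0 : ∀ w : TangentSpace (𝓡 2) x,
      (0 : TangentSpace (𝓡 2) ((x, (0 : 𝔼 2)) : (𝕊 2) × 𝔼 2).1 →L[ℝ]
        TangentSpace 𝓘(ℝ, 𝔼 2) ((Prod.snd ∘ tubeTransition ν₁ ν₂)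
          (((x, (0 : 𝔼 2)) : (𝕊 2) × 𝔼 2).1, ((x, (0 : 𝔼 2)) : (𝕊 2) × 𝔼 2).2))) w = 0 :=
    fun w => rfl
  erw [h0, zero_add, mfderiv_eq_fderiv]
  rfl

/-- **Block structure of the differential of the transition map at the zero section**:
`Dτ(x, 0) (ξ, 0) = (ξ, 0)` (the zero section is fixed pointwise). [folklore] -/
theorem mfderiv_tubeTransition_horizontal (x : 𝕊 2) (ξ : TangentSpace (𝓡 2) x) :
    mfderiv I𝕋 I𝕋 (tubeTransition ν₁ ν₂) (x, 0)
      ((ξ, 0) : TangentSpace I𝕋 ((x, (0 : 𝔼 2)) : (𝕊 2) × 𝔼 2)) =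
      (ξ, 0) := by
  have h := mfderiv_prod_eq_add_apply (I := 𝓡 2) (I' := 𝓘(ℝ, 𝔼 2)) (I'' := I𝕋)
    (f := tubeTransition ν₁ ν₂) (p := ((x, (0 : 𝔼 2)) : (𝕊 2) × 𝔼 2))
    (v := ((ξ, 0) : TangentSpace I𝕋 ((x, (0 : 𝔼 2)) : (𝕊 2) × 𝔼 2)))
    (mdifferentiableAt_tubeTransition ν₁ ν₂ x)
  have h2 : (fun z : 𝕊 2 => tubeTransition ν₁ ν₂ (z, ((x, (0 : 𝔼 2)) : (𝕊 2) × 𝔼 2).2)) =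
      fun z => (z, (0 : 𝔼 2)) := by
    funext z; exact tubeTransition_zero ν₁ ν₂ z
  rw [h2, mfderiv_prod_left] at h
  rw [h]
  erw [map_zero, add_zero]
  rfl

/-- **The fibre derivative is invertible** (injective): `Dτ(x, 0)` is injective and block
triangular. [folklore] -/
theorem injective_fibreDeriv (x : 𝕊 2) : Injective (fibreDeriv ν₁ ν₂ x) := by
  rw [injective_iff_map_eq_zero]
  intro v hv
  set T := mfderiv I𝕋 I𝕋 (tubeTransition ν₁ ν₂) (x, 0) with hT
  set u : TangentSpace I𝕋 ((x, (0 : 𝔼 2)) : (𝕊 2) × 𝔼 2) := (0, v) with hu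
  have h2 : (T u).2 = 0 := by rw [hT, mfderiv_tubeTransition_snd, hu, hv]
  have h1 : T u = T (((T u).1, 0) : TangentSpace I𝕋 ((x, (0 : 𝔼 2)) : (𝕊 2) × 𝔼 2)) := by
    rw [hT, mfderiv_tubeTransition_horizontal]
    exact Prod.ext rfl h2
  have h3 := injective_mfderiv_tubeTransition ν₁ ν₂ x h1
  have := congrArg Prod.snd h3
  simpa [hu] using this

/-- **Smoothness of the fibre derivative along the knot** (the derivative in the vector-space
variable of a jointly smooth map depends smoothly on the manifold parameter; Mathlib's
`ContMDiffAt.mfderiv` read in the trivial tangent coordinates of `ℝ²`). [folklore] -/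
theorem contMDiff_fibreDeriv : ContMDiff (𝓡 2) 𝓘(ℝ, 𝔼 2 →L[ℝ] 𝔼 2) ∞ (fibreDeriv ν₁ ν₂) := by
  intro x₀
  have hf : ContMDiffAt ((𝓡 2).prod 𝓘(ℝ, 𝔼 2)) 𝓘(ℝ, 𝔼 2) ∞
      (uncurry fun (x : 𝕊 2) (w : 𝔼 2) => (tubeTransition ν₁ ν₂ (x, w)).2)
      (x₀, (fun _ => (0 : 𝔼 2)) x₀) := by
    have : (uncurry fun (x : 𝕊 2) (w : 𝔼 2) => (tubeTransition ν₁ ν₂ (x, w)).2) =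
        Prod.snd ∘ tubeTransition ν₁ ν₂ := by
      funext q; rfl
    rw [this]
    exact contMDiffAt_snd.comp _
      (contMDiffAt_tubeTransition ν₁ ν₂ (mem_tubeTransitionDom_zero ν₁ ν₂ x₀))
  have h := ContMDiffAt.mfderiv (I := 𝓘(ℝ, 𝔼 2)) (I' := 𝓘(ℝ, 𝔼 2)) (J := 𝓡 2) (m := ∞)
    (fun (x : 𝕊 2) (w : 𝔼 2) => (tubeTransition ν₁ ν₂ (x, w)).2) (fun _ => (0 : 𝔼 2)) hf
    contMDiffAt_const (by simp)
  rw [inTangentCoordinates_model_space] at h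
  refine h.congr_of_eventuallyEq (Filter.Eventually.of_forall fun x => ?_)
  show fibreDeriv ν₁ ν₂ x =
    mfderiv 𝓘(ℝ, 𝔼 2) 𝓘(ℝ, 𝔼 2) (fun w : 𝔼 2 => (tubeTransition ν₁ ν₂ (x, w)).2) 0
  rw [mfderiv_eq_fderiv]
  rfl

end Transition

/-! ### Fibrewise linear maps of the tube -/

section Fibrewise

variable (g : (𝕊 2) → (𝔼 2 ≃ₗᵢ[ℝ] 𝔼 2))

/-- The **fibrewise map** `(x, w) ↦ (x, g(x) w)` of the tube `𝕊 2 × ℝ²` attached to a family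
`g` of linear isometries of the fibre (a vector bundle automorphism of the trivial bundle).
[folklore] -/
def fibrewiseMap (q : (𝕊 2) × 𝔼 2) : (𝕊 2) × 𝔼 2 := (q.1, g q.1 q.2)

/-- The fibrewise map, unfolded. [folklore] -/
@[simp]
theorem fibrewiseMap_apply (q : (𝕊 2) × 𝔼 2) : fibrewiseMap g q = (q.1, g q.1 q.2) := rfl

/-- The fibrewise map fixes the zero section. [folklore] -/
theorem fibrewiseMap_zero (x : 𝕊 2) : fibrewiseMap g (x, 0) = (x, 0) := by simp

variable {g}

/-- The fibrewise map of a smooth family is smooth. [folklore] -/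
theorem contMDiff_fibrewiseMap
    (hg : ContMDiff I𝕋 𝓘(ℝ, 𝔼 2) ∞ fun p : (𝕊 2) × 𝔼 2 => g p.1 p.2) :
    ContMDiff I𝕋 I𝕋 ∞ (fibrewiseMap g) :=
  contMDiff_fst.prodMk hg

/-- The fibrewise map is differentiable. [folklore] -/
theorem mdifferentiableAt_fibrewiseMap
    (hg : ContMDiff I𝕋 𝓘(ℝ, 𝔼 2) ∞ fun p : (𝕊 2) × 𝔼 2 => g p.1 p.2) (q : (𝕊 2) × 𝔼 2) :
    MDifferentiableAt I𝕋 I𝕋 (fibrewiseMap g) q :=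
  ((contMDiff_fibrewiseMap hg) q).mdifferentiableAt (by simp)

/-- **Differential of a fibrewise map at the zero section**, vertical part:
`D(x, 0) (ξ, v) = (ξ, g(x) v)`, second component. [folklore] -/
theorem mfderiv_fibrewiseMap_snd
    (hg : ContMDiff I𝕋 𝓘(ℝ, 𝔼 2) ∞ fun p : (𝕊 2) × 𝔼 2 => g p.1 p.2) (x : 𝕊 2)
    (u : TangentSpace I𝕋 ((x, (0 : 𝔼 2)) : (𝕊 2) × 𝔼 2)) :
    (mfderiv I𝕋 I𝕋 (fibrewiseMap g) (x, 0) u).2 = g x u.2 := by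
  have hF := mdifferentiableAt_fibrewiseMap hg ((x, (0 : 𝔼 2)) : (𝕊 2) × 𝔼 2)
  have hc := mfderiv_comp ((x, (0 : 𝔼 2)) : (𝕊 2) × 𝔼 2)
    (mdifferentiableAt_snd (I := 𝓡 2) (I' := 𝓘(ℝ, 𝔼 2))) hF
  rw [mfderiv_snd] at hc
  have h1 : (mfderiv I𝕋 I𝕋 (fibrewiseMap g) (x, 0) u).2 =
      mfderiv I𝕋 𝓘(ℝ, 𝔼 2) (Prod.snd ∘ fibrewiseMap g) (x, 0) u := by
    rw [hc]; rfl
  have hG : MDifferentiableAt I𝕋 𝓘(ℝ, 𝔼 2) (Prod.snd ∘ fibrewiseMap g) (x, 0) :=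
    (mdifferentiableAt_snd (I := 𝓡 2) (I' := 𝓘(ℝ, 𝔼 2))).comp _ hF
  have hdec := mfderiv_prod_eq_add_apply (v := u) hG
  have h2 : (fun z : 𝕊 2 => (Prod.snd ∘ fibrewiseMap g) (z, ((x, (0 : 𝔼 2)) : (𝕊 2) × 𝔼 2).2)) =
      fun _ => (0 : 𝔼 2) := by
    funext z
    simp
  rw [h2, mfderiv_const] at hdec
  rw [h1, hdec]
  have h0 : ∀ w : TangentSpace (𝓡 2) x,
      (0 : TangentSpace (𝓡 2) ((x, (0 : 𝔼 2)) : (𝕊 2) × 𝔼 2).1 →L[ℝ]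
        TangentSpace 𝓘(ℝ, 𝔼 2) ((Prod.snd ∘ fibrewiseMap g)
          (((x, (0 : 𝔼 2)) : (𝕊 2) × 𝔼 2).1, ((x, (0 : 𝔼 2)) : (𝕊 2) × 𝔼 2).2))) w = 0 :=
    fun w => rfl
  have h3 : (fun z : 𝔼 2 => (Prod.snd ∘ fibrewiseMap g) (x, z)) =
      (g x).toContinuousLinearEquiv := by
    funext z; simp
  erw [h0, zero_add, mfderiv_eq_fderiv, h3, (g x).toContinuousLinearEquiv.fderiv]
  rfl

/-- **Differential of a fibrewise map at the zero section**, horizontal part: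
`D(x, 0) (ξ, 0) = (ξ, 0)`. [folklore] -/
theorem mfderiv_fibrewiseMap_horizontal
    (hg : ContMDiff I𝕋 𝓘(ℝ, 𝔼 2) ∞ fun p : (𝕊 2) × 𝔼 2 => g p.1 p.2) (x : 𝕊 2)
    (ξ : TangentSpace (𝓡 2) x) :
    mfderiv I𝕋 I𝕋 (fibrewiseMap g) (x, 0)
      ((ξ, 0) : TangentSpace I𝕋 ((x, (0 : 𝔼 2)) : (𝕊 2) × 𝔼 2)) =
      (ξ, 0) := by
  have h := mfderiv_prod_eq_add_apply (I := 𝓡 2) (I' := 𝓘(ℝ, 𝔼 2)) (I'' := I𝕋)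
    (f := fibrewiseMap g) (p := ((x, (0 : 𝔼 2)) : (𝕊 2) × 𝔼 2))
    (v := ((ξ, 0) : TangentSpace I𝕋 ((x, (0 : 𝔼 2)) : (𝕊 2) × 𝔼 2)))
    (mdifferentiableAt_fibrewiseMap hg _)
  have h2 : (fun z : 𝕊 2 => fibrewiseMap g (z, ((x, (0 : 𝔼 2)) : (𝕊 2) × 𝔼 2).2)) =
      fun z => (z, (0 : 𝔼 2)) := by
    funext z; simp
  rw [h2, mfderiv_prod_left] at h
  rw [h]
  erw [map_zero, add_zero]
  rfl

end Fibrewise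

/-! ### The orthogonal frame attached to two tubular neighbourhoods -/

section Frame

variable {K : TwoKnot} (ν₁ ν₂ : TwoKnot.TubularNbhd K)

/-- The first column `A(x) e₀` of the fibre derivative. [folklore] -/
def tubeFrameCol (x : 𝕊 2) : 𝔼 2 := fibreDeriv ν₁ ν₂ x planeE0

/-- The first column of the (invertible) fibre derivative is nonzero. [folklore] -/
theorem tubeFrameCol_ne_zero (x : 𝕊 2) : tubeFrameCol ν₁ ν₂ x ≠ 0 := by
  intro h
  have h0 : planeE0 = 0 := injective_fibreDeriv ν₁ ν₂ x (by rw [map_zero]; exact h)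
  have := congrArg (fun w : 𝔼 2 => w 0) h0
  simp at this

/-- The first column depends smoothly on the point of the knot. [folklore] -/
theorem contMDiff_tubeFrameCol : ContMDiff (𝓡 2) 𝓘(ℝ, 𝔼 2) ∞ (tubeFrameCol ν₁ ν₂) :=
  (contMDiff_fibreDeriv ν₁ ν₂).clm_apply contMDiff_const

/-- The **frame vector** `u(x) = A(x) e₀ / ‖A(x) e₀‖`. [folklore] -/
def tubeFrameVec (x : 𝕊 2) : 𝔼 2 := NormedSpace.normalize (tubeFrameCol ν₁ ν₂ x)

/-- The frame vector is a unit vector. [folklore] -/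
theorem norm_tubeFrameVec (x : 𝕊 2) : ‖tubeFrameVec ν₁ ν₂ x‖ = 1 :=
  NormedSpace.norm_normalize (tubeFrameCol_ne_zero ν₁ ν₂ x)

/-- The frame vector depends smoothly on the point of the knot. [folklore] -/
theorem contMDiff_tubeFrameVec : ContMDiff (𝓡 2) 𝓘(ℝ, 𝔼 2) ∞ (tubeFrameVec ν₁ ν₂) := by
  have hinv : ContMDiff (𝓡 2) 𝓘(ℝ, ℝ) ∞ fun x => ‖tubeFrameCol ν₁ ν₂ x‖⁻¹ := by
    intro x
    have h1 : ContDiffAt ℝ ∞ (fun a : 𝔼 2 => ‖a‖⁻¹) (tubeFrameCol ν₁ ν₂ x) :=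
      (contDiffAt_norm ℝ (tubeFrameCol_ne_zero ν₁ ν₂ x)).inv
        (norm_ne_zero_iff.2 (tubeFrameCol_ne_zero ν₁ ν₂ x))
    exact h1.contMDiffAt.comp x (contMDiff_tubeFrameCol ν₁ ν₂ x)
  exact hinv.smul (contMDiff_tubeFrameCol ν₁ ν₂)

/-- The **orientation function** `⟪A(x) e₁, J u(x)⟫` (sign of `det A(x)`). [folklore] -/
def tubeFrameSign (x : 𝕊 2) : ℝ := ⟪fibreDeriv ν₁ ν₂ x planeE1, quarterTurn (tubeFrameVec ν₁ ν₂ x)⟫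

/-- The orientation function does not vanish. [folklore] -/
theorem tubeFrameSign_ne_zero (x : 𝕊 2) : tubeFrameSign ν₁ ν₂ x ≠ 0 :=
  inner_frame_ne_zero (injective_fibreDeriv ν₁ ν₂ x)

/-- The orientation function is continuous. [folklore] -/
theorem continuous_tubeFrameSign : Continuous (tubeFrameSign ν₁ ν₂) := by
  have h1 : Continuous fun x => fibreDeriv ν₁ ν₂ x planeE1 :=
    ((contMDiff_fibreDeriv ν₁ ν₂).clm_apply contMDiff_const).continuous
  have h2 : Continuous fun x => quarterTurn (tubeFrameVec ν₁ ν₂ x) :=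
    contDiff_quarterTurn.continuous.comp (contMDiff_tubeFrameVec ν₁ ν₂).continuous
  exact h1.inner h2

/-- A point of `𝕊 2`. [folklore] -/
def sphereTwoPt : 𝕊 2 := ⟨EuclideanSpace.single 0 1, by simp⟩

/-- **The orientation of the transition map is constant along the (connected) knot**: there is
a sign `s = ±1` with `s ⟪A(x) e₁, J u(x)⟫ > 0` for all `x`. [folklore] -/
theorem exists_tubeFrameSign : ∃ s : ℝ, s ^ 2 = 1 ∧ ∀ x, 0 < s * tubeFrameSign ν₁ ν₂ x := by
  haveI := preconnectedSpace_sphereTwo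
  have hne := tubeFrameSign_ne_zero ν₁ ν₂
  have hc := continuous_tubeFrameSign ν₁ ν₂
  -- no sign change: otherwise a zero by the intermediate value theorem
  have key : ∀ x y, 0 < tubeFrameSign ν₁ ν₂ x → 0 < tubeFrameSign ν₁ ν₂ y := by
    intro x y hx
    by_contra hy
    have hy : tubeFrameSign ν₁ ν₂ y ≤ 0 := not_lt.1 hy
    have hmem : (0 : ℝ) ∈ Icc (tubeFrameSign ν₁ ν₂ y) (tubeFrameSign ν₁ ν₂ x) := ⟨hy, hx.le⟩
    obtain ⟨z, hz⟩ := intermediate_value_univ y x hc hmem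
    exact hne z hz
  by_cases h0 : 0 < tubeFrameSign ν₁ ν₂ sphereTwoPt
  · exact ⟨1, by norm_num, fun x => by rw [one_mul]; exact key _ _ h0⟩
  · refine ⟨-1, by norm_num, fun x => ?_⟩
    have hx : tubeFrameSign ν₁ ν₂ x < 0 := by
      rcases lt_trichotomy (tubeFrameSign ν₁ ν₂ x) 0 with h | h | h
      · exact h
      · exact absurd h (hne x)
      · exact absurd (key _ _ h) h0
    linarith

variable (s : ℝ) (hs : s ^ 2 = 1)

/-- The **orthogonal frame** `Q(x) = [u(x), s J u(x)]` of the transition map: a smooth family of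
linear isometries of the fibre (the orthogonal factor of the `QR` decomposition of the fibre
derivative `A(x)`). [folklore] -/
def tubeFrame (x : 𝕊 2) : 𝔼 2 ≃ₗᵢ[ℝ] 𝔼 2 :=
  frameIsometry (tubeFrameVec ν₁ ν₂ x) s (norm_tubeFrameVec ν₁ ν₂ x) hs

/-- The orthogonal frame, unfolded. [folklore] -/
theorem tubeFrame_apply (x : 𝕊 2) (w : 𝔼 2) :
    tubeFrame ν₁ ν₂ s hs x w =
      w 0 • tubeFrameVec ν₁ ν₂ x + (s * w 1) • quarterTurn (tubeFrameVec ν₁ ν₂ x) :=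
  frameIsometry_apply _ _ _ _ w

/-- The orthogonal frame is the frame map of the first column. [folklore] -/
theorem tubeFrame_eq_frameMap (x : 𝕊 2) (w : 𝔼 2) :
    tubeFrame ν₁ ν₂ s hs x w =
      frameMap (NormedSpace.normalize (fibreDeriv ν₁ ν₂ x planeE0)) s w := by
  rw [tubeFrame_apply, frameMap_apply]
  rfl

/-- **The orthogonal frame depends smoothly on `(x, w)`.** [folklore] -/
theorem contMDiff_tubeFrame :
    ContMDiff I𝕋 𝓘(ℝ, 𝔼 2) ∞ fun p : (𝕊 2) × 𝔼 2 => tubeFrame ν₁ ν₂ s hs p.1 p.2 := by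
  have hcoord : ∀ i : Fin 2, ContMDiff I𝕋 𝓘(ℝ, ℝ) ∞ fun p : (𝕊 2) × 𝔼 2 => p.2 i := fun i =>
    ((EuclideanSpace.proj (𝕜 := ℝ) i).contDiff.contMDiff).comp contMDiff_snd
  have hu : ContMDiff I𝕋 𝓘(ℝ, 𝔼 2) ∞ fun p : (𝕊 2) × 𝔼 2 => tubeFrameVec ν₁ ν₂ p.1 :=
    (contMDiff_tubeFrameVec ν₁ ν₂).comp contMDiff_fst
  have hJ : ContMDiff I𝕋 𝓘(ℝ, 𝔼 2) ∞ fun p : (𝕊 2) × 𝔼 2 => quarterTurn (tubeFrameVec ν₁ ν₂ p.1) :=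
    contDiff_quarterTurn.comp_contMDiff hu
  have hsc : ContMDiff I𝕋 𝓘(ℝ, ℝ) ∞ fun p : (𝕊 2) × 𝔼 2 => s * p.2 1 :=
    contMDiff_const.mul (hcoord 1)
  have h : ContMDiff I𝕋 𝓘(ℝ, 𝔼 2) ∞ fun p : (𝕊 2) × 𝔼 2 =>
      p.2 0 • tubeFrameVec ν₁ ν₂ p.1 + (s * p.2 1) • quarterTurn (tubeFrameVec ν₁ ν₂ p.1) :=
    ((hcoord 0).smul hu).add (hsc.smul hJ)
  refine h.congr fun p => ?_
  exact tubeFrame_apply ν₁ ν₂ s hs p.1 p.2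

/-- **The straight line from the fibre derivative to its orthogonal frame stays injective**
(`injective_lineToFrame` along the knot, given the constant orientation sign `s`). [folklore] -/
theorem injective_line_tubeFrame (hsgn : ∀ x, 0 < s * tubeFrameSign ν₁ ν₂ x) (x : 𝕊 2) {t : ℝ}
    (ht : t ∈ Icc (0 : ℝ) 1) :
    Injective fun w : 𝔼 2 => (1 - t) • fibreDeriv ν₁ ν₂ x w + t • tubeFrame ν₁ ν₂ s hs x w := by
  have h := injective_lineToFrame (injective_fibreDeriv ν₁ ν₂ x) hs (hsgn x) ht
  intro w w' hww'
  apply h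
  show ((1 - t) • fibreDeriv ν₁ ν₂ x +
      t • frameMap (NormedSpace.normalize (fibreDeriv ν₁ ν₂ x planeE0)) s) w =
    ((1 - t) • fibreDeriv ν₁ ν₂ x +
      t • frameMap (NormedSpace.normalize (fibreDeriv ν₁ ν₂ x planeE0)) s) w'
  simp only [add_apply, FunLike.coe_smul, Pi.smul_apply]
  exact hww'

end Frame

namespace TwoKnot.TubularNbhd

variable {K : TwoKnot}

/-- **A tubular neighbourhood map misses a point of `S⁴`** (`𝕊 2 × ℝ²` is not compact, and `ν`
is an embedding). [folklore] -/
theorem exists_not_mem_range (ν : TwoKnot.TubularNbhd K) : ∃ pt : 𝕊 4, pt ∉ range ν.toFun := by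
  by_contra h
  have h' : ∀ pt, pt ∈ range ν.toFun := fun pt => by_contra fun hpt => h ⟨pt, hpt⟩
  have hr : range ν.toFun = univ := eq_univ_of_forall h'
  have hc : IsCompact (range ν.toFun) := hr ▸ isCompact_univ
  have hc' : IsCompact (univ : Set ((𝕊 2) × 𝔼 2)) := by
    rw [ν.isSmoothEmbedding.isEmbedding.isCompact_iff, image_univ]
    exact hc
  have hE : IsCompact (univ : Set (𝔼 2)) := by
    have himg : Prod.snd '' (univ : Set ((𝕊 2) × 𝔼 2)) = univ :=
      eq_univ_of_forall fun w => ⟨(sphereTwoPt, w), mem_univ _, rfl⟩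
    have := hc'.image continuous_snd
    rwa [himg] at this
  exact noncompact_univ (𝔼 2) hE

/-- The dimension of the tangent spaces of the tube equals that of `ℝ⁴`. [folklore] -/
theorem finrank_tangentSpace_tube (p : (𝕊 2) × 𝔼 2) :
    Module.finrank ℝ (TangentSpace I𝕋 p) = Module.finrank ℝ (𝔼 4) := by
  show Module.finrank ℝ (EuclideanSpace ℝ (Fin 2) × 𝔼 2) = Module.finrank ℝ (𝔼 4)
  simp

/-- **Uniqueness of tubular neighbourhoods of a 2-knot in `S⁴`, as needed for the Gluck twist**
(Kosinski, *Differential Manifolds* (1993), III.(3.5), in the form recorded by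
`Literature.Topology.FourManifolds.TwoKnot.TubularNbhd.uniqueness`): for two tubular neighbourhoods `ν₁`, `ν₂` of the same
2-knot `K` there are a diffeomorphism `φ` of `S⁴` fixing `K` pointwise and a smooth family
`g : S² → O(2)` with `φ (ν₁ (x, w)) = ν₂ (x, g x w)` for `‖w‖` small. Proof: with `τ = ν₂⁻¹ ∘ ν₁`,
`A(x) = ∂_w τ(x, 0)` and `Q(x)` the orthogonal frame of `A(x)` (`Literature.Topology.FourManifolds.tubeFrame`), the map
`P = ν₂ ∘ (id × Q) ∘ ν₁⁻¹`, read in a stereographic chart `ℝ⁴` of `S⁴` missing a point off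
`range ν₂`, fixes the knot pointwise and the straight-line isotopy `(1 - t) id + t P` has
injective derivative along the knot (block triangular with diagonal blocks `id` and
`(1 - t) A + t Q`, `Literature.Topology.FourManifolds.injective_line_tubeFrame`); the straight-line isotopy extension theorem
(`Literature.Topology.FourManifolds.exists_diffeomorph_eqOn_nhdsSet_of_straightLine`, flows of compactly supported vector
fields) gives a compactly supported diffeomorphism of `ℝ⁴` equal to `P` near the knot, which is
transported back to `S⁴` (`Literature.Topology.FourManifolds.exists_diffeomorph_chartTransport`).
[cite: Kosinski1993, Ch. III Thm (3.5)] -/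
theorem exists_diffeomorph_tubeFrame (K : TwoKnot) (ν₁ ν₂ : TwoKnot.TubularNbhd K) :
    ∃ φ : (𝕊 4) ≃ₘ⟮𝓡 4, 𝓡 4⟯ (𝕊 4), (∀ x : 𝕊 2, φ (K x) = K x) ∧
      ∃ g : (𝕊 2) → (𝔼 2 ≃ₗᵢ[ℝ] 𝔼 2),
        ContMDiff ((𝓡 2).prod 𝓘(ℝ, 𝔼 2)) 𝓘(ℝ, 𝔼 2) ∞ (fun p : (𝕊 2) × 𝔼 2 => g p.1 p.2) ∧
        ∃ r : ℝ, 0 < r ∧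
          ∀ (x : 𝕊 2) (w : 𝔼 2), ‖w‖ < r → φ (ν₁.toFun (x, w)) = ν₂.toFun (x, g x w) := by
  -- the orthogonal frame of the transition map
  obtain ⟨s, hs, hsgn⟩ := exists_tubeFrameSign ν₁ ν₂
  set g : (𝕊 2) → (𝔼 2 ≃ₗᵢ[ℝ] 𝔼 2) := tubeFrame ν₁ ν₂ s hs with hg
  have hgsmooth : ContMDiff I𝕋 𝓘(ℝ, 𝔼 2) ∞ (fun p : (𝕊 2) × 𝔼 2 => g p.1 p.2) :=
    contMDiff_tubeFrame ν₁ ν₂ s hs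
  -- a stereographic chart missing a point off `range ν₂`
  obtain ⟨pt, hpt⟩ := ν₂.exists_not_mem_range
  set σ : OpenPartialHomeomorph (𝕊 4) (𝔼 4) := chartAt (𝔼 4) (-pt) with hσ
  haveI : Fact (Module.finrank ℝ (EuclideanSpace ℝ (Fin (4 + 1))) = 4 + 1) :=
    ⟨finrank_euclideanSpace_fin⟩
  have hσsrc : σ.source = {pt}ᶜ := by
    show (stereographic' 4 (-(-pt))).source = {pt}ᶜ
    rw [stereographic'_source, neg_neg]
  have hσtgt : σ.target = univ := by
    show (stereographic' 4 (-(-pt))).target = univ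
    exact stereographic'_target _
  have hσsm : ContMDiffOn (𝓡 4) (𝓡 4) ∞ σ σ.source := contMDiffOn_chart
  have hσsymm : ContMDiff (𝓡 4) (𝓡 4) ∞ σ.symm := by
    have h := contMDiffOn_chart_symm (I := 𝓡 4) (x := -pt) (n := ∞)
    rw [← hσ, hσtgt] at h
    exact contMDiffOn_univ.1 h
  have hν₂src : ∀ q, ν₂.toFun q ∈ σ.source := fun q => by
    rw [hσsrc]
    exact fun h => hpt ⟨q, h⟩
  have hν₁src : ∀ q ∈ tubeTransitionDom ν₁ ν₂, ν₁.toFun q ∈ σ.source := fun q hq => by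
    obtain ⟨q', hq'⟩ := hq
    rw [← hq']
    exact hν₂src q'
  have hdom_nhds : ∀ x : 𝕊 2, tubeTransitionDom ν₁ ν₂ ∈ 𝓝 ((x, (0 : 𝔼 2)) : (𝕊 2) × 𝔼 2) := fun x =>
    (isOpen_tubeTransitionDom ν₁ ν₂).mem_nhds (mem_tubeTransitionDom_zero ν₁ ν₂ x)
  -- the maps
  set Qm : (𝕊 2) × 𝔼 2 → (𝕊 2) × 𝔼 2 := fibrewiseMap g with hQm
  have hQmsm : ContMDiff I𝕋 I𝕋 ∞ Qm := contMDiff_fibrewiseMap hgsmooth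
  set e₁ : (𝕊 2) × 𝔼 2 → 𝔼 4 := fun q => σ (ν₁.toFun q) with he₁
  set e₂ : (𝕊 2) × 𝔼 2 → 𝔼 4 := fun q => σ (ν₂.toFun q) with he₂
  set P : 𝔼 4 → 𝔼 4 := fun y => σ (ν₂.toFun (Qm (ν₁.toHomeo.symm (σ.symm y)))) with hP
  set W : Set (𝔼 4) := σ '' (ν₁.toFun '' tubeTransitionDom ν₁ ν₂) with hW
  set Z : Set (𝔼 4) := range fun x : 𝕊 2 => e₁ (x, 0) with hZ
  -- smoothness of `e₁`, `e₂`
  have he₁sm : ∀ q ∈ tubeTransitionDom ν₁ ν₂, ContMDiffAt I𝕋 (𝓡 4) ∞ e₁ q := fun q hq =>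
    (hσsm.contMDiffAt (σ.open_source.mem_nhds (hν₁src q hq))).comp q (ν₁.contMDiffAt_toFun q)
  have he₂sm : ∀ q, ContMDiffAt I𝕋 (𝓡 4) ∞ e₂ q := fun q =>
    (hσsm.contMDiffAt (σ.open_source.mem_nhds (hν₂src q))).comp q (ν₂.contMDiffAt_toFun q)
  -- `W` is open, `Z` is compact, `Z ⊆ W`
  have hWopen : IsOpen W := by
    apply σ.isOpen_image_of_subset_source (ν₁.isOpen_image (isOpen_tubeTransitionDom ν₁ ν₂))
    rintro _ ⟨q, hq, rfl⟩
    exact hν₁src q hq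
  have hZcpt : IsCompact Z := by
    apply isCompact_range
    show Continuous (e₁ ∘ fun x : 𝕊 2 => ((x, (0 : 𝔼 2)) : (𝕊 2) × 𝔼 2))
    have hon : ContinuousOn e₁ (tubeTransitionDom ν₁ ν₂) := fun q hq =>
      (he₁sm q hq).continuousAt.continuousWithinAt
    exact hon.comp_continuous (continuous_id.prodMk continuous_const)
      fun x => mem_tubeTransitionDom_zero ν₁ ν₂ x
  have hZW : Z ⊆ W := by
    rintro _ ⟨x, rfl⟩
    exact ⟨ν₁.toFun (x, 0), ⟨(x, 0), mem_tubeTransitionDom_zero ν₁ ν₂ x, rfl⟩, rfl⟩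
  -- `P` is smooth on `W`
  have hPsm : ContDiffOn ℝ ∞ P W := by
    rw [← contMDiffOn_iff_contDiffOn]
    rintro _ ⟨_, ⟨q, hq, rfl⟩, rfl⟩
    apply ContMDiffAt.contMDiffWithinAt
    have h1 : ContMDiffAt (𝓡 4) (𝓡 4) ∞ σ.symm (σ (ν₁.toFun q)) := hσsymm _
    have h2 : ContMDiffAt (𝓡 4) I𝕋 ∞ ν₁.toHomeo.symm (σ.symm (σ (ν₁.toFun q))) := by
      rw [σ.left_inv (hν₁src q hq)]
      exact ν₁.contMDiffAt_toHomeo_symm ⟨q, rfl⟩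
    have h21 : ContMDiffAt (𝓡 4) I𝕋 ∞ (ν₁.toHomeo.symm ∘ σ.symm) (σ (ν₁.toFun q)) :=
      h2.comp _ h1
    have h3 : ContMDiffAt I𝕋 (𝓡 4) ∞ (fun p => σ (ν₂.toFun (Qm p)))
        ((ν₁.toHomeo.symm ∘ σ.symm) (σ (ν₁.toFun q))) := (he₂sm _).comp _ (hQmsm _)
    exact ContMDiffAt.comp (σ (ν₁.toFun q)) (g := fun p => σ (ν₂.toFun (Qm p))) h3 h21
  -- `P` fixes `Z`
  have hPe₁ : ∀ q ∈ tubeTransitionDom ν₁ ν₂, P (e₁ q) = e₂ (Qm q) := fun q hq => by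
    simp only [hP, he₁, he₂]
    rw [σ.left_inv (hν₁src q hq), ν₁.toHomeo_symm_apply]
  have hPZ : ∀ z ∈ Z, P z = z := by
    rintro _ ⟨x, rfl⟩
    rw [hPe₁ _ (mem_tubeTransitionDom_zero ν₁ ν₂ x)]
    simp only [he₁, he₂, hQm, fibrewiseMap_zero, ν₁.apply_zero, ν₂.apply_zero]
  have hPderiv : ∀ z ∈ Z, HasFDerivAt P (fderiv ℝ P z) z := fun z hz =>
    ((hPsm.contDiffAt (hWopen.mem_nhds (hZW hz))).differentiableAt (by simp)).hasFDerivAt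
  -- **the derivative of the straight-line isotopy is injective along the knot**
  have hinj : ∀ z ∈ Z, ∀ t ∈ Icc (0 : ℝ) 1, Injective (slDeriv t (fderiv ℝ P z)) := by
    rintro _ ⟨x, rfl⟩ t ht
    set p₀ : (𝕊 2) × 𝔼 2 := (x, 0) with hp₀
    have hp₀dom : p₀ ∈ tubeTransitionDom ν₁ ν₂ := mem_tubeTransitionDom_zero ν₁ ν₂ x
    -- differentials of `e₁`, `e₂`
    letI : FiniteDimensional ℝ (TangentSpace I𝕋 p₀) :=
      inferInstanceAs (FiniteDimensional ℝ (EuclideanSpace ℝ (Fin 2) × 𝔼 2))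
    set M₁ : TangentSpace I𝕋 p₀ →L[ℝ] 𝔼 4 := mfderiv I𝕋 (𝓡 4) e₁ p₀ with hM₁
    set M₂ : TangentSpace I𝕋 p₀ →L[ℝ] 𝔼 4 := mfderiv I𝕋 (𝓡 4) e₂ p₀ with hM₂
    have hM₁d : HasMFDerivAt I𝕋 (𝓡 4) e₁ p₀ M₁ :=
      ((he₁sm p₀ hp₀dom).mdifferentiableAt (by simp)).hasMFDerivAt
    have hM₂d : HasMFDerivAt I𝕋 (𝓡 4) e₂ p₀ M₂ :=
      ((he₂sm p₀).mdifferentiableAt (by simp)).hasMFDerivAt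
    have hσinj : ∀ p ∈ σ.source, Injective (mfderiv (𝓡 4) (𝓡 4) σ p) := fun p hp =>
      (mdifferentiable_chart (I := 𝓡 4) (-pt)).mfderiv_injective hp
    have hσd : ∀ p ∈ σ.source, MDifferentiableAt (𝓡 4) (𝓡 4) σ p := fun p hp =>
      (hσsm.contMDiffAt (σ.open_source.mem_nhds hp)).mdifferentiableAt (by simp)
    have hM₂inj : Injective M₂ := by
      have hc := mfderiv_comp p₀ (hσd _ (hν₂src p₀))
        ((ν₂.contMDiffAt_toFun p₀).mdifferentiableAt (by simp))
      rw [hM₂, show e₂ = σ ∘ ν₂.toFun from rfl, hc]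
      intro u v huv
      exact ν₂.injective_mfderiv_toFun _ (hσinj _ (hν₂src p₀) huv)
    have hM₁inj : Injective M₁ := by
      have hc := mfderiv_comp p₀ (hσd _ (hν₁src p₀ hp₀dom))
        ((ν₁.contMDiffAt_toFun p₀).mdifferentiableAt (by simp))
      rw [hM₁, show e₁ = σ ∘ ν₁.toFun from rfl, hc]
      intro u v huv
      exact ν₁.injective_mfderiv_toFun _ (hσinj _ (hν₁src p₀ hp₀dom) huv)
    have hM₁surj : Surjective M₁ :=
      (LinearMap.injective_iff_surjective_of_finrank_eq_finrank
        (f := (M₁ : TangentSpace I𝕋 p₀ →ₗ[ℝ] 𝔼 4)) (finrank_tangentSpace_tube p₀)).1 hM₁inj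
    -- the transition map: `e₁ = e₂ ∘ τ` near `p₀`, so `M₁ = M₂ ∘ Dτ`
    set Tτ : TangentSpace I𝕋 p₀ →L[ℝ] TangentSpace I𝕋 p₀ := mfderiv I𝕋 I𝕋 (tubeTransition ν₁ ν₂) p₀
      with hTτ
    have hTτd : HasMFDerivAt I𝕋 I𝕋 (tubeTransition ν₁ ν₂) p₀ Tτ :=
      (mdifferentiableAt_tubeTransition ν₁ ν₂ x).hasMFDerivAt
    have he₁τ : e₁ =ᶠ[𝓝 p₀] (e₂ ∘ tubeTransition ν₁ ν₂) := by
      filter_upwards [hdom_nhds x] with q hq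
      simp only [he₁, he₂, comp_apply, apply_tubeTransition ν₁ ν₂ hq]
    have hM₁eq : M₁ = M₂.comp Tτ := by
      have h2' : HasMFDerivAt I𝕋 (𝓡 4) e₂ (tubeTransition ν₁ ν₂ p₀) M₂ := by
        rw [hp₀, tubeTransition_zero]; exact hM₂d
      have hc := (h2'.comp p₀ hTτd).congr_of_eventuallyEq he₁τ
      exact hc.mfderiv
    -- the fibrewise map: `P ∘ e₁ = e₂ ∘ Qm` near `p₀`
    set TQ : TangentSpace I𝕋 p₀ →L[ℝ] TangentSpace I𝕋 p₀ := mfderiv I𝕋 I𝕋 Qm p₀ with hTQ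
    have hTQd : HasMFDerivAt I𝕋 I𝕋 Qm p₀ TQ := ((hQmsm p₀).mdifferentiableAt (by simp)).hasMFDerivAt
    have hline : (slIsotopy P t ∘ e₁) =ᶠ[𝓝 p₀] ((1 - t) • e₁ + t • (e₂ ∘ Qm)) := by
      filter_upwards [hdom_nhds x] with q hq
      simp only [comp_apply, slIsotopy, Pi.add_apply, Pi.smul_apply, hPe₁ q hq]
      rw [smul_sub, sub_smul, one_smul]
      abel
    -- derivative of the left-hand side
    have hh : HasMFDerivAt (𝓡 4) (𝓡 4) (slIsotopy P t) (e₁ p₀) (slDeriv t (fderiv ℝ P (e₁ p₀))) :=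
      hasMFDerivAt_iff_hasFDerivAt.2 (hasFDerivAt_slIsotopy' t (hPderiv _ ⟨x, rfl⟩))
    have hL : HasMFDerivAt I𝕋 (𝓡 4) (slIsotopy P t ∘ e₁) p₀
        ((slDeriv t (fderiv ℝ P (e₁ p₀))).comp M₁) := hh.comp p₀ hM₁d
    -- derivative of the right-hand side
    have he₂Q : HasMFDerivAt I𝕋 (𝓡 4) (e₂ ∘ Qm) p₀ (M₂.comp TQ) := by
      have h2' : HasMFDerivAt I𝕋 (𝓡 4) e₂ (Qm p₀) M₂ := by
        rw [hQm, hp₀, fibrewiseMap_zero]; exact hM₂d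
      exact h2'.comp p₀ hTQd
    have hR : HasMFDerivAt I𝕋 (𝓡 4) ((1 - t) • e₁ + t • (e₂ ∘ Qm)) p₀
        ((1 - t) • M₁ + t • (M₂.comp TQ)) :=
      (hM₁d.const_smul (1 - t)).add (he₂Q.const_smul t)
    have hEq : (slDeriv t (fderiv ℝ P (e₁ p₀))).comp M₁ = (1 - t) • M₁ + t • (M₂.comp TQ) :=
      hL.mfderiv.symm.trans (hR.congr_of_eventuallyEq hline).mfderiv
    -- conclusion
    refine (injective_iff_map_eq_zero _).2 fun v hv => ?_
    obtain ⟨u, rfl⟩ := hM₁surj v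
    have h1 : ((1 - t) • M₁ + t • (M₂.comp TQ)) u = 0 := by
      rw [← hEq]
      exact hv
    rw [hM₁eq] at h1
    have h2 : M₂ ((1 - t) • Tτ u + t • TQ u) = 0 := by
      rw [map_add, map_smul, map_smul]
      exact h1
    have h3 : (1 - t) • Tτ u + t • TQ u = 0 := (injective_iff_map_eq_zero _).1 hM₂inj _ h2
    -- second components: `((1 - t) A + t Q) u.2 = 0`, so `u.2 = 0`
    have hT2 : (Tτ u).2 = fibreDeriv ν₁ ν₂ x u.2 := mfderiv_tubeTransition_snd ν₁ ν₂ x u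
    have hQ2 : (TQ u).2 = g x u.2 := mfderiv_fibrewiseMap_snd hgsmooth x u
    have h4 : (1 - t) • (Tτ u).2 + t • (TQ u).2 = (0 : 𝔼 2) := congrArg Prod.snd h3
    rw [hT2, hQ2] at h4
    have hu2 : u.2 = 0 := by
      have hinjl := injective_line_tubeFrame ν₁ ν₂ s hs hsgn x ht
      apply hinjl
      simp only [map_zero, smul_zero, add_zero]
      exact h4
    -- first components: `u.1 = 0`
    have hu : u = ((u.1, 0) : TangentSpace I𝕋 ((x, (0 : 𝔼 2)) : (𝕊 2) × 𝔼 2)) :=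
      Prod.ext rfl hu2
    have hT1 : Tτ ((u.1, 0) : TangentSpace I𝕋 ((x, (0 : 𝔼 2)) : (𝕊 2) × 𝔼 2)) = (u.1, 0) :=
      mfderiv_tubeTransition_horizontal ν₁ ν₂ x u.1
    have hQ1 : TQ ((u.1, 0) : TangentSpace I𝕋 ((x, (0 : 𝔼 2)) : (𝕊 2) × 𝔼 2)) = (u.1, 0) :=
      mfderiv_fibrewiseMap_horizontal hgsmooth x u.1
    rw [hu, hT1, hQ1] at h3
    have h5 : (1 - t) • u.1 + t • u.1 = (0 : EuclideanSpace ℝ (Fin 2)) := congrArg Prod.fst h3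
    have hu1 : u.1 = 0 := by
      have : ((1 - t) + t) • u.1 = 0 := by rw [add_smul]; exact h5
      simpa using this
    rw [hu, hu1]
    exact map_zero M₁
  -- **the isotopy extension theorem** in the chart, and transport back to `S⁴`
  obtain ⟨Φ, hΦP, R, hΦR⟩ := exists_diffeomorph_eqOn_nhdsSet_of_straightLine hZcpt hWopen hZW
    hPsm hPZ hPderiv hinj
  obtain ⟨H, hH, -⟩ := exists_diffeomorph_chartTransport (φ := σ) hσsm hσsymm hσtgt Φ hΦR
  -- the neighbourhood of the knot where `Φ = P`
  obtain ⟨U, hUopen, hZU, hUP⟩ : ∃ U : Set (𝔼 4), IsOpen U ∧ Z ⊆ U ∧ ∀ y ∈ U, Φ y = P y := by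
    obtain ⟨U, hUo, hZU', hUsub⟩ := mem_nhdsSet_iff_exists.1 hΦP
    exact ⟨U, hUo, hZU', fun y hy => hUsub hy⟩
  have hHν₁ : ∀ q ∈ tubeTransitionDom ν₁ ν₂, e₁ q ∈ U → H (ν₁.toFun q) = ν₂.toFun (Qm q) := by
    intro q hq hqU
    have h1 : ν₁.toFun q = σ.symm (e₁ q) := (σ.left_inv (hν₁src q hq)).symm
    rw [h1, hH, hUP _ hqU, hPe₁ q hq]
    exact σ.left_inv (hν₂src _)
  refine ⟨H, fun x => ?_, g, hgsmooth, ?_⟩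
  · -- `H` fixes the knot
    have h := hHν₁ (x, 0) (mem_tubeTransitionDom_zero ν₁ ν₂ x) (hZU ⟨x, rfl⟩)
    rwa [hQm, fibrewiseMap_zero, ν₁.apply_zero, ν₂.apply_zero] at h
  · -- a uniform tube `𝕊 2 × B_r` inside the good set (tube lemma)
    set V : Set ((𝕊 2) × 𝔼 2) := tubeTransitionDom ν₁ ν₂ ∩ e₁ ⁻¹' U with hV
    have hVopen : IsOpen V := by
      rw [isOpen_iff_mem_nhds]
      rintro q ⟨hq, hqU⟩
      refine Filter.inter_mem ((isOpen_tubeTransitionDom ν₁ ν₂).mem_nhds hq) ?_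
      exact (he₁sm q hq).continuousAt.preimage_mem_nhds (hUopen.mem_nhds hqU)
    have hsub : (univ : Set (𝕊 2)) ×ˢ ({0} : Set (𝔼 2)) ⊆ V := by
      rintro ⟨x, w⟩ ⟨-, hw⟩
      rw [mem_singleton_iff] at hw
      subst hw
      exact ⟨mem_tubeTransitionDom_zero ν₁ ν₂ x, hZU ⟨x, rfl⟩⟩
    obtain ⟨u₀, v₀, -, hv₀, hu₀, h0v₀, huv⟩ :=
      generalized_tube_lemma isCompact_univ isCompact_singleton hVopen hsub
    obtain ⟨r, hr, hrv⟩ := Metric.isOpen_iff.1 hv₀ 0 (h0v₀ rfl)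
    refine ⟨r, hr, fun x w hw => ?_⟩
    have hq : ((x, w) : (𝕊 2) × 𝔼 2) ∈ V := huv ⟨hu₀ (mem_univ x), hrv (mem_ball_zero_iff.2 hw)⟩
    have h := hHν₁ (x, w) hq.1 hq.2
    rwa [hQm, fibrewiseMap_apply] at h

end TwoKnot.TubularNbhd

/-! ### The discharges -/

/-- **Uniqueness of tubular neighbourhoods of 2-knots in `S⁴`** — discharge of the named fact
`Literature.Topology.FourManifolds.TwoKnot.TubularNbhd.uniqueness` (Kosinski, *Differential Manifolds* (1993), Ch. III,
Thm. (3.5)). [cite: Kosinski1993, Ch. III Thm (3.5)] -/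
theorem TwoKnot.TubularNbhd.uniqueness_holds : TwoKnot.TubularNbhd.uniqueness :=
  fun K ν₁ ν₂ => TwoKnot.TubularNbhd.exists_diffeomorph_tubeFrame K ν₁ ν₂

section Gluck

variable {EX HX HX' : Type*} [NormedAddCommGroup EX] [NormedSpace ℝ EX] [TopologicalSpace HX]
  {IX : ModelWithCorners ℝ EX HX} [TopologicalSpace HX'] {IX' : ModelWithCorners ℝ EX HX'}
  {X X' : Type*} [TopologicalSpace X] [ChartedSpace HX X] [TopologicalSpace X']
  [ChartedSpace HX' X'] {K K' : TwoKnot}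

/-- **The Gluck twist is well defined** — discharge of the named fact
`Literature.Topology.FourManifolds.nonempty_diffeomorph_of_isGluckTwist` (`GluckTwist.lean`): if `X` is a Gluck twist of `S⁴`
along `K`, `X'` a Gluck twist along `K'` (arbitrary tubular neighbourhoods, either fibre
orientation) and `K`, `K'` are ambient isotopic, then `X ≅ X'` (H. Gluck, Trans. AMS 104 (1962),
§8). Assembled from isotopy invariance (`GluckTwistTransport.lean`), locality in the tubular
neighbourhood (`GluckTwistLocality.lean`), absorption of smooth `O(2)`-valued fibre
reparametrisations (`GluckTwistFibre.lean`, `GluckTwistUniqueness.lean`) and the uniqueness of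
tubular neighbourhoods proved above. [cite: GluckTAMS1962, §8] -/
theorem nonempty_diffeomorph_of_isGluckTwist_holds :
    nonempty_diffeomorph_of_isGluckTwist (IX := IX) (IX' := IX') (X := X) (X' := X') (K := K)
      (K' := K') :=
  nonempty_diffeomorph_of_isGluckTwist_of_uniqueness TwoKnot.TubularNbhd.uniqueness_holds

end Gluck

end Literature.Topology.FourManifolds

end
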